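import Summits.BirchSwinnertonDyer.Rank1Residual.F1Sign2.ResidueTraceGoverningLawAtTwo
import HarnessLib.Audit.Tags
import HarnessLib

/-!
# Cell `bsd-f1-sign2` — descent lens (planner `-desc` g24; MEMO-desc §33 + add1): GENUS-CLASS SWITCHING AT 2 — DESC-33-Iσ/I `RamifiedClassInvolution{Switch,ShaAnLaw}AtTwo`,
# DESC-33-Jσ/J `UnramifiedClassTwoInvolution{Switch,ShaAnLaw}AtTwo`, DESC-33-H `AdmissibleTwistFourDividesShaAnAtTwo`, DESC-33-P `TwistShaAnOddIffSelmerTrivialAtTwo`, the per-curve rows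
# DESC-33-Iσ446/I446 `Curve446RamifiedClass{SelmerSwitch,ShaAnParity}`, L33-AMB `Curve446SplitCofactorLegendreLaw`, P48(ν=0) `Curve446SplitPrimeNuZeroLaw` (+ carriers and -desc's three glue lemmas)

STATEMENTS ONLY (+ -desc's three proved glue lemmas), typer -ty g18.  Port asked by -desc g24 (R33c «port `QuarticRootlessMod` + Iσ/Jσ helpers iff REF1 passes», INBOX 2026-08-29T12:23:52Z),
REF-GATED until REF1 g18 §196 (R33a, 12:43:26Z; R196e «Sketch33 rows UN-GATED by REF1»), §196-add1 (a) (v2 per-curve rows «both rows UN-GATED», 12:47Z) and §198 (v3 rows L33-AMB + P48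
SURVIVE, 13:12Z).  Source: `HOME/MEMO-desc-data/g24/lean/Sketch33.lean` **05740d9968396f1e** (v3, 256 l.; l.1–211 byte-identical to v2 3f8f649f2f08f5c0 whose eight §196 decls are byte-identical
to v1 2d7d3c11cc5b1e18; farm rc 0, 0 sorries per -desc and REF1) l.34–255 VERBATIM (prelude, 10 carriers, 10 rows, 3 glue lemmas; decl bodies byte-identical to the sketch AND to REF1's
probes `HOME/REF1-data/b196/lean/Probe196b.lean` 635ea9a889db3e87 / `Probe196c.lean` 200850a80e81a91d / `HOME/REF1-data/b198/lean/Probe198.lean` 539e6c840d3d3885, builder-verified;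
ns `Summit.BirchSwinnertonDyer.Rank1Residual.F1Sign2`; `@[conjecture]` rows I / J / H / P / I446 / L33-AMB / P48 keep the attribute, Iσ / Jσ / Iσ446 plain per R196e); each docstring =
-desc's VERBATIM + one REF1-AUDIT rider + the REF2-PLACEMENT v53 status (§12.5 R33b, §16.2 R33b-3, §19/§20 L33-R1, §22, §26); -desc's free-form multi-key cite brackets are split into
one cite tag per key (locators verbatim) and `Waldspurger1981` ↦ the tree's key `Waldspurger1981Fourier` (J. Math. Pures Appl. 60 (1981), same paper).
R196e: `FrobTwoSplitAt` ≡ -desc g23 Sketch32's `TwoTorsionSplitModP` — ONE tree name, THIS file's (Sketch32 G/B are GATED on R196a's `ℚ`/`padicValRat` re-type and not ported here;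
`DoorResidueDegree` (shared by Sketch31/32) is not needed by §33 and lands once with that port).
GRADES (REF1-AUDIT §196 / §196-add1 / §198, evidence `HOME/REF1-data/b196/`, `b198/` SHA16.txt): Iσ, Jσ PRINT-ASSEMBLY in ALL `dim S^X` cases (REF1 (vi), R196d wording); I, J
`@[conjecture]` = Iσ/Jσ ∧ (BSD₂ mod 2 on the family); H ⟸ BSD₂ + branch; P = THE target (BSD₂-parity for rank-0 twins, open in print at 2); Iσ446 PRINT-ASSEMBLY fully explicit (446a1 =
`[1,1,0,−30,52]`, `Δ = 2⁶·223`, minimal; `T₃ = x⁴−x³−x²+2`, `disc T₃ = 2²·223` ⟹ no bound on `r`, R196h); I446 = THE CERTIFICATE TARGET (Hecke certificate (α)–(η), ENGINE 44/46, 44b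
pending with -desc g25; R196g = REF2 R33b-3: the glue through P is an ALTERNATIVE CONDITIONAL route, not the certificate's); L33-AMB SURVIVES (17/17 groups, 10/17 cross-class, 0
violations — but as typed across X3 ∪ X7 it contains a NOT-IN-PRINT local lemma at the additive prime 2, REF2 §20); P48(ν=0) SURVIVES (8/8); glue ×3 CLEAN; carriers CLEAN; KILLED none.
BC5: ENGINE 41e (kit j330270) + laws43 1 679/1 679 and 422/422; ENGINE 43 (kit j330680, PARI `ellrank` + `ell2cover`) 2 668/2 668; ENGINE 44 (kit j330620) (M33′) 28/28; ENGINE 47/48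
(kit j331464 / j331539); R196c breadth ask (≥ 2 further branch curves) OPEN with -desc g25 / -data.  REF2 grade of record: (M33′) NEW-COMBINATION; Iσ/Jσ/Iσ446/L33-AMB-clause
print-assembly; residual = FIMR-type spin (print's name).  PARTITION none.  Beyond-print theorem: no (pending 44b + certificate).  BSD is not proved.  bears_on:
stmt-BirchSwinnertonDyer-19099 `RankOneAtTwo` / leaf `NonCMAtTwo` (as `ResidueTraceGoverningLawAtTwo.lean`).

## -desc's module docstring of `Sketch33.lean` (verbatim; cite brackets normalised)

# Sketch33 — cell bsd-f1-sign2, seat -desc g24 (LENS descent / visibility), MEMO-desc §33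

**THE ± OBJECT AT 2 ON A GENUS CLASS IS A CONSTANT SELMER GROUP `S^X`; EVERY SQUAREFREE TWIST IN THE CLASS IS OBTAINED FROM IT BY
MAZUR–RUBIN SWITCHES AT THE PRIME FACTORS, AND THE WEIGHT-3/2 COEFFICIENT `c(n) mod 2` (2-RAMIFIED CLASSES) IS THE `ε`-TRACE OF THE
FIRST-ORDER DEFORMATION OF `ρ̄_{E,2}` IN THE DIRECTION OF THE GENERATOR OF `S^X`.**

Setting: `W` on the rank-one odd branch `OnOddBranchRankOneAtTwo` (tree: `Δ_W > 0`, `E(ℚ)[2] = 0`, rank 1, `#Sel₂(W) = 2`, `#Sel₂(W^{(d)}) = 4` for every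
descent-admissible `d`).  A GENUS CLASS of twists `W^{(−n)}` (`n` squarefree, all prime factors odd and of good reduction) is fixed by `−n mod 8` and the
Legendre symbols `(−n/ℓ)` at the odd bad primes `ℓ` (`SameGenusClassAtTwo`); it is 2-UNRAMIFIED when `−n ≡ 1 (mod 8)` and 2-RAMIFIED when `−n ≡ 3, 7 (mod 8)`.
Frobenius types of a good odd prime `q` on `E[2]` (`Gal = S₃`): 3-CYCLE (`a_q` odd), INVOLUTION (`a_q` even, one root of the 2-division cubic mod `q`), SPLIT.
For a class `s ∈ H¹(ℚ, E[2])` with quartic (2-covering) `T_s`, `loc_q s ≠ 0 ∈ H¹_ur(ℚ_q, E[2]) = 𝔽₂` at an involution prime `q ∤ disc T_s` iff `T_s` has NO root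
mod `q` (`QuarticRootlessMod`; the roots of `T_s` are the `E[2]`-torsor of `s`).

§33 rows (MEMO-desc §33; data: ENGINE 41e = kit j330098/j330270, the weight-3/2 packet vectors of `W = 446a1` to `n ≤ 20 000`; census `an43/laws43.py`):
 * DESC-33-Iσ `RamifiedClassInvolutionSwitchAtTwo` (support, print-grade: Mazur–Rubin / Poonen–Rains switching): on a 2-ramified class the members with exactly
   one involution factor `r` (all other factors 3-cycles) have `Sel₂ = 0` iff a FIXED quartic `T` (the torsor of the generator of the constant line `S^X`) has no
   root mod `r`.  [cite: MazurRubin2010, (Invent. 181) §3–4] [cite: Kramer1981, Prop. 6] [cite: PoonenRains2012, §4]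
 * DESC-33-I `RamifiedClassInvolutionShaAnLawAtTwo` (THE §33 THEOREM-CANDIDATE beyond print, analytic side): same members, `#Ш_an(W^{(−n)})` is ODD iff `T` has no
   root mod `r`.  ENGINE 41e/laws43 V2-I: `446a1`, classes `−n ≡ 3, 7 (mod 8)`, `(−n/223) = +1`, all `1679` members `n ≤ 20 000` with one involution factor:
   `c(n)` odd `⟺ ρ_r(s₁) + ρ_r(s₂) = 1`, `0` exceptions (`T = T_{s₁+s₂}`); proposed proof: the `𝔽₂[ε]`-eigenform `F̄ + ε·(v₂θ mod 2)` (M33, ENGINE 44).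
 * DESC-33-Jσ / DESC-33-J `UnramifiedClassTwoInvolution{Switch,ShaAnLaw}AtTwo`: on the 2-unramified class (`S^A` = the constant Selmer PLANE of the tree hypothesis)
   the members with exactly two involution factors `r₁, r₂` have `Sel₂ = 0` (resp. `#Ш_an` odd) iff the bit-vectors `ρ_{r₁}, ρ_{r₂} ∈ 𝔽₂²` read off two fixed
   quartics are linearly independent.  laws43 V1-J: `422/422` (`236` with `v₂c = 1`, all independent; `186` deeper, all dependent).
 * DESC-33-H `AdmissibleTwistFourDividesShaAnAtTwo`: for EVERY descent-admissible `d` (all factors 3-cycles, composite allowed) `4 ∣ #Ш_an(W^{(d)})`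
   (`Sel₂ = S^A` is the full plane, rank `0`).  laws43 V1-F cell `(i,s) = (0,0)`: all members, `v₂ c(n) ≥ 1`, sharp.
 * DESC-33-P `TwistShaAnOddIffSelmerTrivialAtTwo` (`@[conjecture]`, the BSD₂-mod-2 target the rows serve): `#Ш_an(W^{(−n)})` odd iff `#Sel₂(W^{(−n)}) = 1`.
 Kernel glue: `I` from `Iσ ∧ P`, `J` from `Jσ ∧ P` (so a proof of the analytic rows I/J by the modular mechanism gives instances of P that no printed method reaches).
-/

open scoped Classical

open WeierstrassCurve Literature.NumberTheory.EllipticCurves Polynomial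

namespace Summit.BirchSwinnertonDyer.Rank1Residual.F1Sign2

/-- `n ≥ 1` squarefree with every prime factor an odd prime of good reduction (the twists `W^{(−n)}` we index).
REF1-AUDIT §196 (A2′): `≡ 0 < n ∧ Squarefree n ∧` every prime `q ∣ n` is odd and good ✓ (carrier CLEAN). -/
def TwistSupportGoodOdd (W : WeierstrassCurve ℚ) [W.IsGloballyMinimal] (n : ℕ) : Prop :=
  0 < n ∧ Squarefree n ∧ ∀ q : ℕ, q.Prime → q ∣ n → q ≠ 2 ∧ ∀ _h : Fact q.Prime, W.HasGoodReductionAtPrime q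

/-- `−n` and `−n₀` lie in the same GENUS CLASS: same square class at `2` (`mod 8`, `n` odd) and at every odd prime of bad reduction.
REF1-AUDIT §196 (A2′) BC7-12: reflexive, symmetric — an equivalence on labels (same square class of `−n` at `2` and at every odd bad `ℓ`) ✓. -/
def SameGenusClassAtTwo (W : WeierstrassCurve ℚ) [W.IsGloballyMinimal] (n₀ n : ℕ) : Prop :=
  (-(n : ℤ)) % 8 = (-(n₀ : ℤ)) % 8 ∧
    ∀ ℓ : ℕ, ℓ.Prime → ℓ ≠ 2 → (∀ _h : Fact ℓ.Prime, ¬ W.HasGoodReductionAtPrime ℓ) →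
      jacobiSym (-(n : ℤ)) ℓ = jacobiSym (-(n₀ : ℤ)) ℓ

/-- SPLIT prime: the 2-division cubic of the minimal model splits completely modulo the odd prime `q` (`Frob_q = 1` on `E[2]`).
REF1-AUDIT §196 R196e: ≡ -desc g23 Sketch32's `TwoTorsionSplitModP` — ONE tree name: THIS is the tree decl (Sketch32's G/B rows, gated on R196a, will reuse it when ported); carrier CLEAN. -/
def FrobTwoSplitAt (W : WeierstrassCurve ℚ) [W.IsGloballyMinimal] (q : ℕ) : Prop :=
  ∀ _h : Fact q.Prime, (((integralModelInt W).map (Int.castRingHom (ZMod q))).twoTorsionPolynomial.toPoly).Splits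

/-- INVOLUTION prime: `a_q` even and `Frob_q ≠ 1` on `E[2]` (exactly one root of the 2-division cubic mod `q`).
REF1-AUDIT §196: carrier CLEAN (`a_q` even and `Frob_q ≠ 1` on `E[2]` = exactly one root of the 2-division cubic mod `q`; `frobeniusTrace` = `a_q` at good `q`). -/
def FrobTwoInvolutionAt (W : WeierstrassCurve ℚ) [W.IsGloballyMinimal] (q : ℕ) : Prop :=
  Even (W.frobeniusTrace q) ∧ ¬ FrobTwoSplitAt W q

/-- The integer quartic `T` has no root modulo `r`. For the 2-covering quartic `T_s` of `s ∈ H¹(ℚ, E[2])` and an involution prime `r` of good reduction for `T_s`: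
`loc_r s ≠ 0` in `H¹_ur(ℚ_r, E[2]) ≅ 𝔽₂`.
REF1-AUDIT §196 / §196-add1: carrier CLEAN; for `T₃ = x⁴ − x³ − x² + 2` REF1's kernel table: involution primes 5, 7, 13, 19, 43 → 0 roots, 31, 47 → 2 roots; 3-cycle primes
3, 11, 17, 23, 29, 37, 41 → exactly 1 root (the S₄-cycle-type pattern of the torsor quartic of a class with full `E[2]⋊S₃` image); `r = 0, 1` junk excluded by `r.Prime` in the rows.
-desc g24 R33c: the carrier -desc asked the typer to port. -/
def QuarticRootlessMod (T : ℤ[X]) (r : ℕ) : Prop :=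
  ∀ x : ZMod r, (T.map (Int.castRingHom (ZMod r))).eval x ≠ 0

/-- `n` has exactly one prime factor `r` of involution type; every other prime factor is a 3-cycle prime (`a_q` odd).
REF1-AUDIT §196: carrier CLEAN. -/
def OneInvolutionRestCycles (W : WeierstrassCurve ℚ) [W.IsGloballyMinimal] (n r : ℕ) : Prop :=
  r.Prime ∧ r ∣ n ∧ FrobTwoInvolutionAt W r ∧ ∀ q : ℕ, q.Prime → q ∣ n → q ≠ r → Odd (W.frobeniusTrace q)

/-- `n` has exactly two prime factors `r₁ ≠ r₂` of involution type; every other prime factor is a 3-cycle prime.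
REF1-AUDIT §196: carrier CLEAN. -/
def TwoInvolutionsRestCycles (W : WeierstrassCurve ℚ) [W.IsGloballyMinimal] (n r₁ r₂ : ℕ) : Prop :=
  r₁ ≠ r₂ ∧ r₁.Prime ∧ r₂.Prime ∧ r₁ ∣ n ∧ r₂ ∣ n ∧ FrobTwoInvolutionAt W r₁ ∧ FrobTwoInvolutionAt W r₂ ∧
    ∀ q : ℕ, q.Prime → q ∣ n → q ≠ r₁ → q ≠ r₂ → Odd (W.frobeniusTrace q)

/-- The bit-vectors `(a, b)` and `(c, d)` of `𝔽₂²` are linearly independent: both non-zero and distinct.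
REF1-AUDIT §196: carrier CLEAN (both non-zero and distinct = linear independence in `𝔽₂²`). -/
def IndependentBitPairs (a b c d : Prop) : Prop :=
  (a ∨ b) ∧ (c ∨ d) ∧ ¬ ((a ↔ c) ∧ (b ↔ d))

/-- **DESC-33-Iσ `RamifiedClassInvolutionSwitchAtTwo` (support, print-grade).**  For `W` on the odd branch and a 2-RAMIFIED genus class (`−n₀ ≡ 3, 7 (mod 8)`) there are an
integer quartic `T` and a bound `B` such that for every member `n` of the class with exactly one involution factor `r > B` (all other factors 3-cycles):
`Sel₂(W^{(−n)}) = 0 ⟺ T` has no root mod `r`.  (`T` = the 2-covering quartic of the generator of the constant Selmer line `S^X` when `dim S^X = 1`; `T = X⁴` when `dim S^X ≥ 3`.)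
BC5 (two engines, `446a1`, all `1679` members `n ≤ 20 000` of the classes `(3,+), (7,+)` with one involution factor): PARI `ellrank` gives `Sel₂ = 0` iff `x⁴ − x³ − x² + 2` has no root
mod `r` (`1034` yes / `645` no), and `ell2cover` finds exactly this quartic as the unramified 2-covering on `16/16` sampled members (ENGINE 43, kit j330680).
[cite: MazurRubin2010, §3 (twisting and local conditions at one prime)] [cite: Kramer1981, Prop. 6] [cite: PoonenRains2012, §4 (the image of the relaxed Selmer group is one of the two Lagrangian lines)]
REF1-AUDIT §196 (R33a; Sketch33 2d7d3c11cc5b1e18, Probe196b 635ea9a889db3e87 farm rc 0): **SURVIVES — PRINT-ASSEMBLY in ALL dimension cases** (REF1's derivation (vi), sharper than the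
docstring — R196d: read «`T = X⁴` when `dim S^X ≥ 3`» as «`T = X⁴` whenever `dim S^X ≥ 2`; for `dim S^X = 0` the law is CONSTANT on one-involution members by 2-parity, `T = X⁴` or
`T = (X² − Δ_W)²` (rootless exactly at involution primes); `dim S^X = 1`: `T = T_{s_X}`» — so the `∃ T` row is print-grade for EVERY curve and label, not only 446a1's dim-1 classes);
R196c (BC5 breadth, -desc g25 / -data): run ENGINE 41e + 43 on ≥ 2 further branch curves — one with ODD conductor, one with ≥ 2 odd bad primes — before I/J are quoted as laws beyond
446a1.  R196e: plain `def` (support).  REF2-PLACEMENT v53 §12.5 / §16.2 (b029f6daca38610c): PRINT-ASSEMBLY ([cite: Kramer1981, Prop. 1–3] / Mazur–Rubin switching for the 2-Selmer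
rank under twist by a prime of prescribed Frobenius in `ℚ(W[2])`; the rootless-quartic condition is the Frobenius class of `r` in the S₄/S₃ tower; cf.
[cite: Morgan2023KummerGeneric, Prop. 19] for the affine-in-square-class shape). -/
def RamifiedClassInvolutionSwitchAtTwo : Prop :=
  ∀ (W : WeierstrassCurve ℚ) [W.IsElliptic] [W.IsGloballyMinimal], OnOddBranchRankOneAtTwo W →
    ∀ n₀ : ℕ, ((-(n₀ : ℤ)) % 8 = 3 ∨ (-(n₀ : ℤ)) % 8 = 7) →
      ∃ (T : ℤ[X]) (B : ℕ), T.natDegree = 4 ∧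
        ∀ n r : ℕ, TwistSupportGoodOdd W n → SameGenusClassAtTwo W n₀ n → OneInvolutionRestCycles W n r → B < r →
          (twistSelmerTwoCard W (-(n : ℤ)) = 1 ↔ QuarticRootlessMod T r)

/-- **DESC-33-I `RamifiedClassInvolutionShaAnLawAtTwo` (THE §33 THEOREM-CANDIDATE, beyond print; analytic side).**  Same `W`, class, `T`, `B`: for every member `n` with exactly
one involution factor `r > B` and every globally minimal model `W'` of `W^{(−n)}` of analytic rank `0`, `#Ш_an(W')` is a non-zero rational with `v₂ = 0` (ODD) iff `T` has no root mod `r`.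
BC5: ENGINE 41e (kit j330270, `446a1`, `n ≤ 20 000`) + `laws43.py` V2-I: `1679/1679` members of the classes `(−n mod 8, (−n/223)) = (3,+), (7,+)`, `T = T_{s₁+s₂}`;
(in BSD₂ currency `2·v₂ c(n) = v₂ #Ш_an + i(n) + 2 s(n) − 1`, Waldspurger); second engine ENGINE 43 (kit j330680, PARI `ellrank` + `ell2cover`): `Sel₂ = 0` on exactly the same
`1679` members, `T = x⁴ − x³ − x² + 2`, `B = 0`.  Mechanism (M33′, ENGINE 44 = kit j330620, exact at level `1784`, all odd `p ≤ 47`): the `𝔽₂`-Hecke module of `v₂θ mod 2` is free of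
rank one over `B₀ = 𝔽₂[a,u]/(a²,u²)` with `T_p ↦ (a_p(W) + a·[p involution]·ρ_p(s₁+s₂))·(1 + u·[p ≡ 3 (4)])` — so `c(n) mod 2` is a Frobenian function read by a finite certificate.
[cite: Waldspurger1981Fourier, Thm 1] [cite: BaruchMao2007, Thm 1.1] [cite: MazurRubin2010, §3] [cite: Mazur1977, (Eisenstein ideal, §II.16–18: first-order eigenforms / generalized eigenvalues)]
REF1-AUDIT §196: **SURVIVES as `@[conjecture]`** = Iσ ∧ (BSD₂ mod 2 on the family); correct `ℚ`/`v₂` currency (contrast Sketch32 G/B, R196a); BC5 = two engines × ONE curve (R196c breadth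
ask).  REF2-PLACEMENT v53 §12.5 (R33b): mechanism (M33′) «`𝕋̄·Ḡ_j ≅ B₀ = 𝔽₂[a,u]/(a²,u²)`» graded NEW-COMBINATION (certificate sound in outline pending ENGINE 44b/46; DELTA sentence of
MEMO-desc §33.7 accurate; nearest CalegariEmerton2009 / [cite: KimingRustom2018SIGMA] / [cite: MazurRubin2010] / Zhai2016–CaiLiZhai2019); -desc g24/REF2 §22/§26: the RESIDUAL
at split primes (K33 refuted by ENGINE 47; AMB2 resolved by law P48 with the S₃-analogue `κ₀` of the FIMR spin [cite: FIMR2013Spin, Thm. 2]) lives in the rows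
`Curve446SplitCofactorLegendreLaw` / `Curve446SplitPrimeNuZeroLaw` below.  Beyond-print theorem: NO (pending the 44b certificate); BSD not proved.  Typer: `Waldspurger1981` ↦ tree
key `Waldspurger1981Fourier` (J. Math. Pures Appl. 60) in the cite tags. -/
@[conjecture] def RamifiedClassInvolutionShaAnLawAtTwo : Prop :=
  ∀ (W : WeierstrassCurve ℚ) [W.IsElliptic] [W.IsGloballyMinimal], OnOddBranchRankOneAtTwo W →
    ∀ n₀ : ℕ, ((-(n₀ : ℤ)) % 8 = 3 ∨ (-(n₀ : ℤ)) % 8 = 7) →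
      ∃ (T : ℤ[X]) (B : ℕ), T.natDegree = 4 ∧
        ∀ n r : ℕ, TwistSupportGoodOdd W n → SameGenusClassAtTwo W n₀ n → OneInvolutionRestCycles W n r → B < r →
          ∀ (W' : WeierstrassCurve ℚ) [W'.IsElliptic] [W'.IsGloballyMinimal],
            (∃ C : VariableChange ℚ, C • W.quadraticTwist (-(n : ℚ)) = W') → W'.analyticRank = 0 →
              ∃ x : ℚ, shaAn W' = (x : ℂ) ∧ x ≠ 0 ∧ (padicValRat 2 x = 0 ↔ QuarticRootlessMod T r)

/-- **DESC-33-Jσ `UnramifiedClassTwoInvolutionSwitchAtTwo` (support, print-grade).**  For `W` on the odd branch there are two integer quartics `T₁, T₂` (2-coverings of a basis of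
the constant Selmer plane `S^A = Sel₂(W^{(−q)})`, `q` admissible) and a bound `B` such that for every squarefree `n` of the 2-UNRAMIFIED class (`−n ≡ 1 (mod 8)`, `(−n/ℓ) = 1` at
the odd bad `ℓ`) with exactly two involution factors `r₁, r₂ > B` (all other factors 3-cycles): `Sel₂(W^{(−n)}) = 0 ⟺` the vectors `([T₁ rootless mod rᵢ], [T₂ rootless mod rᵢ])`,
`i = 1, 2`, are linearly independent in `𝔽₂²`.  BC5 (ENGINE 43, kit j330680, PARI `ellrank`): `422/422` members `n ≤ 20 000` of the class of `446a1` (`236` with `Sel₂ = 0`, all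
independent; `186` with `dim Sel₂ = 2`, all dependent), `T₁ = x⁴−2x³−5x²+2x+3`, `T₂ = x⁴−2x³+5x²−2x+5`, `B = 0`.  [cite: MazurRubin2010, §3] [cite: Kramer1981, Prop. 6] [cite: PoonenRains2012, §4]
REF1-AUDIT §196: **SURVIVES — PRINT-ASSEMBLY** (all `dim S^X` cases, (vi)); R196e plain `def` (support).  REF2 v53 §12.5: as Iσ. -/
def UnramifiedClassTwoInvolutionSwitchAtTwo : Prop :=
  ∀ (W : WeierstrassCurve ℚ) [W.IsElliptic] [W.IsGloballyMinimal], OnOddBranchRankOneAtTwo W →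
    ∃ (T₁ T₂ : ℤ[X]) (B : ℕ), T₁.natDegree = 4 ∧ T₂.natDegree = 4 ∧
      ∀ n r₁ r₂ : ℕ, TwistSupportGoodOdd W n → (-(n : ℤ)) % 8 = 1 →
        (∀ ℓ : ℕ, ℓ.Prime → ℓ ≠ 2 → (∀ _h : Fact ℓ.Prime, ¬ W.HasGoodReductionAtPrime ℓ) → jacobiSym (-(n : ℤ)) ℓ = 1) →
          TwoInvolutionsRestCycles W n r₁ r₂ → B < r₁ → B < r₂ →
            (twistSelmerTwoCard W (-(n : ℤ)) = 1 ↔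
              IndependentBitPairs (QuarticRootlessMod T₁ r₁) (QuarticRootlessMod T₂ r₁) (QuarticRootlessMod T₁ r₂) (QuarticRootlessMod T₂ r₂))

/-- **DESC-33-J `UnramifiedClassTwoInvolutionShaAnLawAtTwo` (theorem-candidate, beyond print; analytic side).**  Same `W`, `T₁`, `T₂`, `B`: for the same members `n` and every
globally minimal model `W'` of `W^{(−n)}` of analytic rank `0`, `#Ш_an(W')` is a non-zero rational with `v₂ = 0` iff the two bit-vectors are independent.  BC5: laws43 V1-J on ENGINE 41e (j330270): `422/422`
members `n ≤ 20 000` of the class of `446a1` (`2·v₂ c(n) = v₂ #Ш_an + 2`): `236` with `c(n)` exactly divisible by `2`, all independent; `186` deeper, all dependent.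
Mechanism: the second-order (`𝔽₂[ε₁,ε₂]`, Heisenberg) trace module of `v₁θ mod 2` (§32 C32), coefficient `ε₁ε₂`.  [cite: Waldspurger1981Fourier, Thm 1] [cite: BaruchMao2007, Thm 1.1] [cite: MazurRubin2010, §3]
REF1-AUDIT §196: **SURVIVES as `@[conjecture]`** = Jσ ∧ (BSD₂ mod 2 on the family); BC5 two engines × one curve (R196c).  REF2 v53 §12.5: mechanism = second-order (Heisenberg)
trace module, §32 C32 NEW-COMBINATION and CORRECTED by (M33′). -/
@[conjecture] def UnramifiedClassTwoInvolutionShaAnLawAtTwo : Prop :=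
  ∀ (W : WeierstrassCurve ℚ) [W.IsElliptic] [W.IsGloballyMinimal], OnOddBranchRankOneAtTwo W →
    ∃ (T₁ T₂ : ℤ[X]) (B : ℕ), T₁.natDegree = 4 ∧ T₂.natDegree = 4 ∧
      ∀ n r₁ r₂ : ℕ, TwistSupportGoodOdd W n → (-(n : ℤ)) % 8 = 1 →
        (∀ ℓ : ℕ, ℓ.Prime → ℓ ≠ 2 → (∀ _h : Fact ℓ.Prime, ¬ W.HasGoodReductionAtPrime ℓ) → jacobiSym (-(n : ℤ)) ℓ = 1) →
          TwoInvolutionsRestCycles W n r₁ r₂ → B < r₁ → B < r₂ →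
            ∀ (W' : WeierstrassCurve ℚ) [W'.IsElliptic] [W'.IsGloballyMinimal],
              (∃ C : VariableChange ℚ, C • W.quadraticTwist (-(n : ℚ)) = W') → W'.analyticRank = 0 →
                ∃ x : ℚ, shaAn W' = (x : ℂ) ∧ x ≠ 0 ∧
                  (padicValRat 2 x = 0 ↔ IndependentBitPairs (QuarticRootlessMod T₁ r₁) (QuarticRootlessMod T₂ r₁)
                    (QuarticRootlessMod T₁ r₂) (QuarticRootlessMod T₂ r₂))

/-- **DESC-33-H `AdmissibleTwistFourDividesShaAnAtTwo` (theorem-candidate; variant of DESC-30-N₀ / (H_min) extended to COMPOSITE admissible twists).**  For `W` on the odd branch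
and every descent-admissible `d` (every prime factor a 3-cycle prime), every globally minimal model of `W^{(d)}` of analytic rank `0` has `v₂(#Ш_an) ≥ 2` (`Sel₂(W^{(d)}) = S^A` is the
full plane by the branch hypothesis, so `Ш[2] ≅ (ℤ/2)²`).  BC5: laws43 V1-F, cell `(i,s) = (0,0)` of the class of `446a1`, `n ≤ 20 000`: `v₂ c(n) ≥ 1` for all members, sharp.
[cite: Kramer1981, Prop. 6] [cite: MazurRubin2010, §3] [cite: Waldspurger1981Fourier, Thm 1]
REF1-AUDIT §196: **SURVIVES (`@[conjecture]`, ⟸ BSD₂ + branch; composite admissible `d` included ✓ — matches `OnOddBranchRankOneAtTwo`'s `∀ d` clause)**; variant of DESC-30-N₀ /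
(H_min) (`F1Sign2/ResidueTraceGoverningLawAtTwo.lean`). -/
@[conjecture] def AdmissibleTwistFourDividesShaAnAtTwo : Prop :=
  ∀ (W : WeierstrassCurve ℚ) [W.IsElliptic] [W.IsGloballyMinimal], OnOddBranchRankOneAtTwo W →
    ∀ d : ℤ, DescAdmissible W d →
      ∀ (W' : WeierstrassCurve ℚ) [W'.IsElliptic] [W'.IsGloballyMinimal],
        (∃ C : VariableChange ℚ, C • W.quadraticTwist (d : ℚ) = W') → W'.analyticRank = 0 →
          ∃ x : ℚ, shaAn W' = (x : ℂ) ∧ x ≠ 0 ∧ 2 ≤ padicValRat 2 x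

/-- **DESC-33-P `TwistShaAnOddIffSelmerTrivialAtTwo` (`@[conjecture]`: BSD₂ modulo 2 on the twist family — the target the §33 rows serve).**  For `W` on the odd branch, every
squarefree `n` supported on odd good primes and every globally minimal model `W'` of `W^{(−n)}` of analytic rank `0`: `#Ш_an(W')` is a non-zero rational with `v₂(#Ш_an) = 0` iff `#Sel₂(W^{(−n)}) = 1`.
(BSD₂ gives `#Ш_an = #Ш` and, for rank `0` without rational 2-torsion, `#Sel₂ = #Ш[2]`.)
REF1-AUDIT §196: **SURVIVES (`@[conjecture]`; THE target: BSD₂(W^{(−n)}) mod 2 for rank-0 twins; `n = 1` included, fine)**.  REF2-PLACEMENT v53 §16.2 R33b-3: this is a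
2-PART-OF-BSD parity statement for the twists (rank 0: `Sel₂ = 0 ⟺ Ш[2] = 0` given `E′(ℚ)[2] = 0`, and «`#Ш_an` odd ⟺ `#Ш` odd» is BSD₂-parity — OPEN IN PRINT at `p = 2` for
non-CM rank-0 twists in general); the glue lemmas through it are ALTERNATIVE CONDITIONAL routes, NOT the certificate's route to I446 (R196g).  Conversely, once the Hecke
certificate lands I446, the pair (Iσ446 print-assembly, I446 certified) PROVES this row RESTRICTED to the two genus classes X3 ∪ X7 of 446a1-twists with `L ≠ 0` — a BSD₂-parity
INSTANCE THEOREM on two genus classes (modulo the Waldspurger packet formula): the corollary row to record when ENGINE 44b lands (REF2 §16.3). -/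
@[conjecture] def TwistShaAnOddIffSelmerTrivialAtTwo : Prop :=
  ∀ (W : WeierstrassCurve ℚ) [W.IsElliptic] [W.IsGloballyMinimal], OnOddBranchRankOneAtTwo W →
    ∀ n : ℕ, TwistSupportGoodOdd W n →
      ∀ (W' : WeierstrassCurve ℚ) [W'.IsElliptic] [W'.IsGloballyMinimal],
        (∃ C : VariableChange ℚ, C • W.quadraticTwist (-(n : ℚ)) = W') → W'.analyticRank = 0 →
          ∃ x : ℚ, shaAn W' = (x : ℂ) ∧ x ≠ 0 ∧ (padicValRat 2 x = 0 ↔ twistSelmerTwoCard W (-(n : ℤ)) = 1)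

/-- **DESC-33-Iσ446 `Curve446RamifiedClassSelmerSwitch` (support, print-assembly; the fully explicit per-curve instance of DESC-33-Iσ).**  For `W = 446a1 =
[1,1,0,−30,52]` and every squarefree `n` with good odd support, `−n ≡ 3, 7 (mod 8)`, `(−n/223) = +1` (the two 2-RAMIFIED genus classes `X3`, `X7`, whose constant Selmer line is
spanned by `s₃ = κ(P) + s₂` with 2-covering quartic `T₃ = x⁴ − x³ − x² + 2`), exactly one involution factor `r` and 3-cycle cofactors: `Sel₂(W^{(−n)}) = 0 ⟺ T₃` has no root
mod `r` (no bound on `r`: `T₃` is separable modulo every prime `∉ {2, 223}`).  BC5 (ENGINE 43, kit j330680, PARI `ellrank`): `1679/1679` members `n ≤ 20 000` (`1034` with `Sel₂ = 0`,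
`645` with `dim Sel₂ = 2`).  [cite: MazurRubin2010, §3 Prop. 3.3] [cite: Kramer1981, Prop. 6] [cite: PoonenRains2012, §4]
REF1-AUDIT §196-add1 (a) (Sketch33 v2 3f8f649f2f08f5c0; Probe196c 200850a80e81a91d farm rc 0 · 2 sorries · 9 BC7 lemmas): **SURVIVES — PRINT-ASSEMBLY support row, fully explicit**
(REF1 recomputed `[1,1,0,−30,52]`: `b₂ = 5, b₄ = −60, b₆ = 208`, `Δ = 14 272 = 2⁶·223 > 0`, `c₄ = 1 465` odd ⟹ multiplicative at 2, `N = 446`; `v₂(Δ) = 6 < 12` ⟹ the model IS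
globally minimal, so the instance binder is satisfiable and pins 446a1; the cubic `4x³+5x²−120x+208` has no root mod 3 ⟹ no rational 2-torsion ✓; `bc7_T3_natDegree = 4`;
`bc7_T3_rootless_mod_5/_13` + ENGINE 43 rows at `n = 5, 13, 61` agree; `disc(T₃) = 892 = 2²·223` (resultant) ⟹ DROPPING `B < r` IS SOUND — R196h: «no bound on `r`» is
justified by `disc(T₃) = 2²·223`).  REF2-PLACEMENT v53 §16.2: PRINT-ASSEMBLY ([cite: Kramer1981, Prop. 1–3] / Mazur–Rubin switching; [cite: Morgan2023KummerGeneric, Prop. 19]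
shape). -/
def Curve446RamifiedClassSelmerSwitch : Prop :=
  ∀ (W : WeierstrassCurve ℚ) [W.IsElliptic] [W.IsGloballyMinimal],
    W.a₁ = 1 → W.a₂ = 1 → W.a₃ = 0 → W.a₄ = -30 → W.a₆ = 52 → OnOddBranchRankOneAtTwo W →
      ∀ n r : ℕ, TwistSupportGoodOdd W n → ((-(n : ℤ)) % 8 = 3 ∨ (-(n : ℤ)) % 8 = 7) → jacobiSym (-(n : ℤ)) 223 = 1 →
        OneInvolutionRestCycles W n r →
          (twistSelmerTwoCard W (-(n : ℤ)) = 1 ↔ QuarticRootlessMod (X ^ 4 - X ^ 3 - X ^ 2 + 2 : ℤ[X]) r)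

/-- **DESC-33-I446 `Curve446RamifiedClassShaAnParity` (THE CERTIFICATE TARGET; per-curve instance of DESC-33-I with `T = x⁴−x³−x²+2`, `B = 0`).**  Same `W = 446a1`, same members
`n`: for every globally minimal model `W'` of `W^{(−n)}` of analytic rank `0`, `#Ш_an(W')` is a non-zero rational `x` with `v₂(x) = 0 ⟺ T₃` rootless mod `r`.  BC5: laws43 V2-I
on ENGINE 41e (kit j330270): `1679/1679` (`c(n)` odd on `1034`, even on `645`; `2v₂ c(n) = v₂ #Ш_an + 1`).  CERTIFICATE (MEMO-desc §33.5 + §33-add1): exact `𝔽₂[a,u]/(a²,u²)`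
Hecke module of `v₂θ mod 2` at level `1784` (ENGINE 44, kit j330620) + separation of `H¹(G_{ℚ,{2,223,∞}}, ad W[2])` trace functions by the primes `{3,5,11,13,17,19,23,43}` (ENGINE 46,
kit j331205) + Carayol ⟹ `c₂(n) mod 2` law for all `n`, pending only the Sturm-span stability run (ENGINE 44b); the analytic translation uses the cited Waldspurger packet formula.
[cite: Waldspurger1981Fourier, Thm 1] [cite: BaruchMao2007, Thm 1.1] [cite: Carayol1994, Thm 3] [cite: Sturm1987, Thm 1]
REF1-AUDIT §196-add1 (a): **SURVIVES (`@[conjecture]`; THE CERTIFICATE TARGET; correct `ℚ`/`v₂` currency; instance binders satisfiable and pin 446a1's minimal model)**.  R196g = REF2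
v53 §16.2 R33b-3 (adopted verbatim): the glue `curve446ShaAnParity_of_switch_of_parity` through `TwistShaAnOddIffSelmerTrivialAtTwo` is an ALTERNATIVE route CONDITIONAL on a
BSD₂-type input (not used by the certificate); the §33.5/§33-add1 certificate ((α)–(η): Sturm [cite: Sturm1987, Thm. 1] + [cite: Carayol1994, Thm. 3] + explicit lift + 8-prime
separation (ENGINE 46) + the Waldspurger packet formula [cite: Waldspurger1981Fourier, Thm. 1] / [cite: BaruchMao2007, Thm. 1.1]) reaches I446 DIRECTLY from `c₂(n) mod 2`
without Selmer groups, conditional only on the cited packet formula; -desc g25 harvests ENGINE 44b (kit j330963, Sturm-span stability) this generation.  REF2 §14.2: ENGINE 46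
separation certificate CLOSED step (3) in outline.  Beyond-print theorem: NO until 44b + the Lean certificate land; BSD not proved. -/
@[conjecture] def Curve446RamifiedClassShaAnParity : Prop :=
  ∀ (W : WeierstrassCurve ℚ) [W.IsElliptic] [W.IsGloballyMinimal],
    W.a₁ = 1 → W.a₂ = 1 → W.a₃ = 0 → W.a₄ = -30 → W.a₆ = 52 → OnOddBranchRankOneAtTwo W →
      ∀ n r : ℕ, TwistSupportGoodOdd W n → ((-(n : ℤ)) % 8 = 3 ∨ (-(n : ℤ)) % 8 = 7) → jacobiSym (-(n : ℤ)) 223 = 1 →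
        OneInvolutionRestCycles W n r →
          ∀ (W' : WeierstrassCurve ℚ) [W'.IsElliptic] [W'.IsGloballyMinimal],
            (∃ C : VariableChange ℚ, C • W.quadraticTwist (-(n : ℚ)) = W') → W'.analyticRank = 0 →
              ∃ x : ℚ, shaAn W' = (x : ℂ) ∧ x ≠ 0 ∧
                (padicValRat 2 x = 0 ↔ QuarticRootlessMod (X ^ 4 - X ^ 3 - X ^ 2 + 2 : ℤ[X]) r)

/-- Glue: the per-curve analytic parity law follows from the per-curve Selmer switch and BSD₂-parity on the family (DESC-33-P).
REF1-AUDIT §196-add1: kernel-clean (audit class `proof.conditional`, credits nothing).  R196g / REF2 R33b-3: ALTERNATIVE CONDITIONAL route (middle hypothesis = BSD₂-parity for the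
class); NOT the certificate's route. -/
theorem curve446ShaAnParity_of_switch_of_parity (hσ : Curve446RamifiedClassSelmerSwitch) (hP : TwistShaAnOddIffSelmerTrivialAtTwo) :
    Curve446RamifiedClassShaAnParity := by
  intro W _ _ h1 h2 h3 h4 h6 hbr n r hn hcl hj hinv W' _ _ hC hrk
  obtain ⟨x, hx, hx0, hiff⟩ := hP W hbr n hn W' hC hrk
  exact ⟨x, hx, hx0, hiff.trans (hσ W h1 h2 h3 h4 h6 hbr n r hn hcl hj hinv)⟩

/-- Kernel glue: the analytic involution law DESC-33-I follows from the descent switch DESC-33-Iσ and the parity target DESC-33-P (with the same quartic).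
REF1-AUDIT §196: glue CLEAN (kernel, no sorry, hypotheses explicit); conditional on DESC-33-P (R196g). -/
theorem ramifiedShaAnLaw_of_switch_of_parity (hσ : RamifiedClassInvolutionSwitchAtTwo) (hP : TwistShaAnOddIffSelmerTrivialAtTwo) :
    RamifiedClassInvolutionShaAnLawAtTwo := by
  intro W _ _ hW n₀ hn₀
  obtain ⟨T, B, hT, hlaw⟩ := hσ W hW n₀ hn₀
  refine ⟨T, B, hT, ?_⟩
  intro n r hn hcl hinv hB W' _ _ hC hr
  obtain ⟨x, hx, hx0, hodd⟩ := hP W hW n hn W' hC hr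
  exact ⟨x, hx, hx0, hodd.trans (hlaw n r hn hcl hinv hB)⟩

/-- Kernel glue: the analytic two-involution law DESC-33-J follows from the descent switch DESC-33-Jσ and the parity target DESC-33-P.
REF1-AUDIT §196: glue CLEAN; conditional on DESC-33-P (R196g). -/
theorem unramifiedShaAnLaw_of_switch_of_parity (hσ : UnramifiedClassTwoInvolutionSwitchAtTwo) (hP : TwistShaAnOddIffSelmerTrivialAtTwo) :
    UnramifiedClassTwoInvolutionShaAnLawAtTwo := by
  intro W _ _ hW
  obtain ⟨T₁, T₂, B, h₁, h₂, hlaw⟩ := hσ W hW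
  refine ⟨T₁, T₂, B, h₁, h₂, ?_⟩
  intro n r₁ r₂ hn h8 hℓ hinv hB₁ hB₂ W' _ _ hC hr
  obtain ⟨x, hx, hx0, hodd⟩ := hP W hW n hn W' hC hr
  exact ⟨x, hx, hx0, hodd.trans (hlaw n r₁ r₂ hn h8 hℓ hinv hB₁ hB₂)⟩

/-- `n` has exactly one involution factor `r`, exactly one SPLIT factor `p` (odd), and every other prime factor is a 3-cycle prime (`a_q` odd).
REF1-AUDIT §198: carrier CLEAN (Sketch33 v3 05740d9968396f1e). -/
def OneInvolutionOneSplitRestCycles (W : WeierstrassCurve ℚ) [W.IsGloballyMinimal] (n r p : ℕ) : Prop :=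
  r.Prime ∧ p.Prime ∧ p ≠ 2 ∧ r ∣ n ∧ p ∣ n ∧ FrobTwoInvolutionAt W r ∧ FrobTwoSplitAt W p ∧
    ∀ q : ℕ, q.Prime → q ∣ n → q ≠ r → q ≠ p → Odd (W.frobeniusTrace q)

/-- conjecture (L33-AMB, -desc g24 §33-add1c; rank · per-curve law for `446a1`, the cell where the switching calculus is silent): for two members
`−n, −n'` of the 2-ramified genus classes `X3 ∪ X7` (`−n ≡ 3, 7 (8)`, `(−n/223) = +1`) with the SAME involution factor `r` (at which the constant
class `s₃`, quartic `T₃ = x⁴−x³−x²+2`, dies: `T₃` rootless mod `r`) and the SAME split factor `p`, the 2-Selmer groups of `W^{(−n)}`, `W^{(−n')}` are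
both trivial or both not exactly when the 3-cycle cofactors `m = n/(rp)`, `m' = n'/(rp)` have the same Legendre symbol at `p`.  Mechanism (Mazur–Rubin):
the relaxed-at-`p` Lagrangian depends on `(r,p)` only, the twisted Kummer Lagrangian at the `I₀*` prime `p` on the cofactor only through `(m/p)`.
Evidence: 17/17 `(r,p)`-groups, 51 curves, 0 violations (`n ≤ 20000`, PARI `ellrank`); both outcomes occur in every group.
Why it might fail: an `(r,p)` pair where the relaxed image `I` is the unramified Lagrangian (then the outcome would not flip with `(m/p)`).
REF1-AUDIT §198 (Sketch33 v3 05740d9968396f1e; Probe198 539e6c840d3d3885 rc 0 · 2 sorries · 11 BC7 lemmas): **SURVIVES** (L33-AMB; independent re-tally from the raw R43 rows: 17/17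
`(r,p)`-groups, 0 violations; convention `dim Sel₂ = R + s`; the CROSS-CLASS case IS in the data — 10/17 groups mix `−n ≡ 3` and `7 (mod 8)`, 0 violations (REF1 13:12Z, answering
REF2's L33-R1)).  REF2-PLACEMENT v53 §19/§20: the «`(m/p)` only» clause is PRINT-ASSEMBLY from local square classes (no condition at 3-cycle primes: `H¹(ℚ_ℓ, W[2]) = 0`; `d`-independence
at the involution prime because units are squares in `ℚ_{r²}`; at the split `I₀*` prime the twisted Kummer Lagrangian depends on `d = p·u` through `(u/p) = (−r/p)·(m/p)` =
[cite: MazurRubin2010, Lemma 2.10–2.11] refined to WHICH Lagrangian); BUT as typed ACROSS X3 ∪ X7 the row silently ASSERTS A LOCAL LEMMA AT THE ADDITIVE PRIME 2: replacing `d` by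
`5d` (the unramified class) does not change the parity for `446a1^{(d)}`, `d ≡ 3 (4)` (twists additive `I₆*` at 2, `ord₂Δ_W = 6` — NOT covered by MR L.2.10 (iii)/(v); Kramer 1981
Props 1–2 make it a finite local computation) — a bona fide «signed object at 2» datum of the cell, census-backed by the 10 mixed groups; §21/§22: -desc's governing conjecture K33 for
the residual `κ_W(r,p)` and REF2's §19.2 prediction were BOTH REFUTED by ENGINE 47 (kit j331464; recorded); print's name for the residual is the SPIN [cite: FIMR2013Spin, Thm. 2]
(non-Frobenian; Thm. 11.1 Sel₂ jump at split `p` for cyclic cubic `ℚ(E[2])`).  Grade: print-assembly clause + NOT-IN-PRINT local lemma at 2; PARTITION none; BSD not proved. -/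
@[conjecture] def Curve446SplitCofactorLegendreLaw : Prop :=
  ∀ (W : WeierstrassCurve ℚ) [W.IsElliptic] [W.IsGloballyMinimal], W.a₁ = 1 → W.a₂ = 1 → W.a₃ = 0 → W.a₄ = -30 → W.a₆ = 52 →
    OnOddBranchRankOneAtTwo W → ∀ n n' r p : ℕ, TwistSupportGoodOdd W n → TwistSupportGoodOdd W n' →
    ((-(n : ℤ)) % 8 = 3 ∨ (-(n : ℤ)) % 8 = 7) → ((-(n' : ℤ)) % 8 = 3 ∨ (-(n' : ℤ)) % 8 = 7) →
    jacobiSym (-(n : ℤ)) 223 = 1 → jacobiSym (-(n' : ℤ)) 223 = 1 →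
    OneInvolutionOneSplitRestCycles W n r p → OneInvolutionOneSplitRestCycles W n' r p →
    QuarticRootlessMod (X ^ 4 - X ^ 3 - X ^ 2 + 2 : ℤ[X]) r →
    ((twistSelmerTwoCard W (-(n : ℤ)) = 1 ↔ twistSelmerTwoCard W (-(n' : ℤ)) = 1) ↔
      jacobiSym ((n / (r * p) : ℕ) : ℤ) p = jacobiSym ((n' / (r * p) : ℕ) : ℤ) p)

/-- The integer quartic `T` has four roots modulo the prime `p` (for a 2-covering quartic at a split prime: `loc_p` of its class vanishes).
REF1-AUDIT §198: carrier CLEAN (four roots mod `p` = the 2-covering class is locally trivial at the split prime). -/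
def QuarticTotallySplitMod (T : ℤ[X]) (p : ℕ) : Prop :=
  ∀ _h : Fact p.Prime, Multiset.card ((T.map (Int.castRingHom (ZMod p))).roots) = 4

/-- conjecture (L33-SPLIT-ν0, -desc g24 §33-add1i; per-curve law for `446a1`): in the cell of `Curve446SplitCofactorLegendreLaw` but with possibly
DIFFERENT involution factors `r, r'` (both killing `s₃`), if the constant class `s₃` is locally trivial at the common split factor `p` (`T₃` has four
roots mod `p`), triviality of the 2-Selmer group depends on the full cofactor `n/p` only through its Legendre symbol at `p`.  Mechanism: the relaxed
space at `p` then carries two new classes and the relaxed image at `p` is independent of `r`.  Evidence: 8/8 `p`-groups (27 curves, up to six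
different `r` per `p`), 0 violations.  Why it might fail: a `p` where the two new classes are both constrained at `r` (relaxed-at-`r` space larger than `⟨s₃⟩`).
REF1-AUDIT §198: **SURVIVES** (P48, `ν = 0` branch; re-tally 8/8 `p`-groups, 0 violations, 5/8 cross-class).  REF2-PLACEMENT v53 §26 / -desc g24 §33-add1i (AMB2 RESOLVED, law P48, ENGINE 48 kit
j331539): `dim Sel₂(W^{(−rpm)})/2 = κ₀(p) ⊕ [(rm/p) = −1] ⊕ ν(p)·[Frob_r ≠ 1 on ℚ(t_p)]`, `t_p` = the new class of the relaxed-at-`p` structure; `ν = 0`: 8/8 `p`-groups (27 curves)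
`r`-independent — this row; `ν = 1`: 25/25 `p`-groups (83 pairs); `κ₀` = the S₃-analogue of the FIMR spin [cite: FIMR2013Spin, Thm. 2]; -desc g25 runs ENGINE 49 = the SPIN TEST of
`κ₀(p)` (prediction pre-registered).  PARTITION none; BSD not proved. -/
@[conjecture] def Curve446SplitPrimeNuZeroLaw : Prop :=
  ∀ (W : WeierstrassCurve ℚ) [W.IsElliptic] [W.IsGloballyMinimal], W.a₁ = 1 → W.a₂ = 1 → W.a₃ = 0 → W.a₄ = -30 → W.a₆ = 52 →
    OnOddBranchRankOneAtTwo W → ∀ n n' r r' p : ℕ, TwistSupportGoodOdd W n → TwistSupportGoodOdd W n' →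
    ((-(n : ℤ)) % 8 = 3 ∨ (-(n : ℤ)) % 8 = 7) → ((-(n' : ℤ)) % 8 = 3 ∨ (-(n' : ℤ)) % 8 = 7) →
    jacobiSym (-(n : ℤ)) 223 = 1 → jacobiSym (-(n' : ℤ)) 223 = 1 →
    OneInvolutionOneSplitRestCycles W n r p → OneInvolutionOneSplitRestCycles W n' r' p →
    QuarticRootlessMod (X ^ 4 - X ^ 3 - X ^ 2 + 2 : ℤ[X]) r → QuarticRootlessMod (X ^ 4 - X ^ 3 - X ^ 2 + 2 : ℤ[X]) r' →
    QuarticTotallySplitMod (X ^ 4 - X ^ 3 - X ^ 2 + 2 : ℤ[X]) p →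
    ((twistSelmerTwoCard W (-(n : ℤ)) = 1 ↔ twistSelmerTwoCard W (-(n' : ℤ)) = 1) ↔
      jacobiSym ((n / p : ℕ) : ℤ) p = jacobiSym ((n' / p : ℕ) : ℤ) p)

end Summit.BirchSwinnertonDyer.Rank1Residual.F1Sign2
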